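import Summits.CriticalPhenomena.PercolationContinuityZ3.Theorems.Transplant.FKConnectivityAllQAntipodalLevel4
import Literature.Probability.Percolation.KozmaNitzanSeparatingTriple
import HarnessLib

/-!
# Connectivity correlation inequalities for `φ_{w,q}`, every `q > 0` — file 42: **THE GADGET IDENTITIES** — replacing a contracted edge
# by a subdivided parallel copy through an isolated vertex

Support file (`--supports stmt-CriticalPhenomena-4575`), FK sub-lane `prim-bschramm-fk-2` (gen 20); builds on p205010 (kernel theorem,
internal audit signed; external expert review pending).  No definitions, no named facts, no sorries; standard axioms.

A coefficient `[z^{2·1_C + 1_M}] Z_H² Cov_{φ_{z,q}}(f,g)` with a CONTRACTED set `C ≠ ∅` is `½·apPsiC q M C f g` (`…AntipodalMinorDefs`).  This file is the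
algebraic heart of the reduction of contraction cells to deletion cells (memo `bschramm/FROM-fk-2-g20-LEVEL3-ONESUM.md` §6.2): for an edge
`e = uv` (`e ∉ M ∪ C`), a vertex `m` ISOLATED from `M ∪ C` (and `≠ u, v`) and the 2-path `a = um`, `b = mv`, with
`D = apPsiC q M C`, `L = apPsiC q (M ∪ {e}) C` (e live), `K = apPsiC q M (C ∪ {e})` (e contracted) and the same functionals `D', L', K'` of the
live set `M ∪ {a, b}` (the gadget added), for all `f, g` not reading `e, a, b`:
* `FK.gadget_contract_eq`:  `q² · K' = (2 + 2q) · K`;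
* `FK.gadget_live_eq`:      `q² · L' = (2 + q) · L + 2q · K`;
* `FK.gadget_delete_eq`:    `q² · D' = 2 · D + q · L`.
(The four states of `(a, b)` in a complementary pair: both in one replica ⇒ that replica joins `u, v` through `m` and the other keeps `m`
isolated; split ⇒ `m` is pendant in both.)  Iterating over `k` fresh vertices gives `D_k = 2^k D + N₁₀(k) L + N₁₁(k) K` with
`N₁₁ = (2+2q)^k − 2(2+q)^k + 2^k` dominant, whence `K ≤ 0` from the deletion-type inequalities `D_k ≤ 0` (files 43–44).
Cluster-count inputs: `FK.clusterCount_insert_add_ite`, `KNSep.reachable_insert_iff`, and the isolation lemmas below.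
[cite: Grimmett2006, §1.4 eq. (1.20) (p. 15); §3.8 (pp. 61–62)]
-/

noncomputable section

namespace Summit.CriticalPhenomena.PercolationContinuityZ3.Theorems

namespace FK

open Literature.Probability.LatticeModels Literature.Probability.Percolation
open scoped Classical

variable {V : Type*} [Fintype V] {u v m : V}

/-! ### An isolated vertex and the 2-path through it -/

section Isolated

/-- Adding the 2-path `um, mv` through an isolated `m`: the count drops by one, and by one more unless `u ↔ v` already.
[cite: Grimmett2006, §1.2 eq. (1.1) (p. 4)] -/
theorem clusterCount_insert_path2 {X : Finset (Sym2 V)} (hm : ∀ e ∈ X, m ∉ e) (hum : u ≠ m) (hvm : v ≠ m) :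
    clusterCount (↑(insert s(u, m) (insert s(m, v) X)) : BondConfig V) ∅ + 1 +
        (if (openGraph (↑X : BondConfig V)).Reachable u v then 0 else 1) = clusterCount (↑X : BondConfig V) ∅ := by
  have hmX : ∀ e ∈ (↑X : BondConfig V), m ∉ e := fun e he => hm e (Finset.mem_coe.1 he)
  have h1 : clusterCount (↑(insert s(m, v) X) : BondConfig V) ∅ + 1 = clusterCount (↑X : BondConfig V) ∅ :=
    clusterCount_insert_pendant hm hvm.symm
  have h2 := clusterCount_insert_add_ite (insert s(m, v) X) u m
  have hmu : ¬ (openGraph (↑X : BondConfig V)).Reachable u m := not_reachable_of_isolated' hmX hum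
  have hmm : (openGraph (↑X : BondConfig V)).Reachable m m := SimpleGraph.Reachable.refl _
  have hiff : (openGraph (↑(insert s(m, v) X) : BondConfig V)).Reachable u m ↔ (openGraph (↑X : BondConfig V)).Reachable u v := by
    rw [Finset.coe_insert, KNSep.reachable_insert_iff]
    constructor
    · rintro (h | ⟨h, _⟩ | ⟨h, _⟩)
      · exact absurd h hmu
      · exact absurd h hmu
      · exact h
    · exact fun h => Or.inr (Or.inr ⟨h, hmm⟩)
  by_cases hr : (openGraph (↑X : BondConfig V)).Reachable u v
  · rw [if_pos (hiff.2 hr)] at h2; rw [if_pos hr]; omega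
  · rw [if_neg (fun h => hr (hiff.1 h))] at h2; rw [if_neg hr]; omega

omit [Fintype V] in
/-- An edge of the configuration joins its endpoints. [folklore] -/
theorem reachable_of_mem_edge {X : Finset (Sym2 V)} (huv : u ≠ v) (he : s(u, v) ∈ X) :
    (openGraph (↑X : BondConfig V)).Reachable u v := by
  refine SimpleGraph.Adj.reachable ?_
  unfold openGraph
  rw [SimpleGraph.fromEdgeSet_adj]
  exact ⟨he, huv⟩

end Isolated

/-! ### The three gadget identities -/

section Gadget

variable {M C : Finset (Sym2 V)} {q : ℝ} {f g : Finset (Sym2 V) → ℝ}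

omit [Fintype V] in
/-- Power bookkeeping: `n + 1 + [¬P] = E ⇒ q²·qⁿ = (q if P else 1)·q^E`. [folklore] -/
theorem pow_gadget1 {n E : ℕ} {P : Prop} [Decidable P] (h : n + 1 + (if P then 0 else 1) = E) :
    q ^ 2 * q ^ n = (if P then q else 1) * q ^ E := by
  split_ifs with hP
  · rw [if_pos hP, add_zero] at h; rw [← h]; ring
  · rw [if_neg hP] at h; rw [← h]; ring

omit [Fintype V] in
/-- Power bookkeeping: `n + 2 = E ⇒ q²·qⁿ = q^E`. [folklore] -/
theorem pow_gadget2 {n E : ℕ} (h : n + 2 = E) : q ^ 2 * q ^ n = q ^ E := by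
  rw [← h]; ring

omit [Fintype V] in
/-- Power bookkeeping: `n + [¬P] = E ⇒ q·qⁿ = (q if P else 1)·q^E`. [folklore] -/
theorem pow_gadgetT {n E : ℕ} {P : Prop} [Decidable P] (h : n + (if P then 0 else 1) = E) :
    q * q ^ n = (if P then q else 1) * q ^ E := by
  split_ifs with hP
  · rw [if_pos hP, add_zero] at h; rw [← h]
  · rw [if_neg hP] at h; rw [← h]; ring


omit [Fintype V] in
/-- Per-configuration bookkeeping shared by the three identities: complements inside the enlarged live sets. [folklore] -/
theorem sdiff_gadget {a b : Sym2 V} (hab : a ≠ b) (haM : a ∉ M) (hbM : b ∉ M) {γ : Finset (Sym2 V)} (hγ : γ ⊆ M) :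
    insert a (insert b M) \ γ = insert a (insert b (M \ γ)) ∧
    insert a (insert b M) \ insert b γ = insert a (M \ γ) ∧
    insert a (insert b M) \ insert a γ = insert b (M \ γ) ∧
    insert a (insert b M) \ insert a (insert b γ) = M \ γ := by
  have haγ : a ∉ γ := fun h => haM (hγ h)
  have hbγ : b ∉ γ := fun h => hbM (hγ h)
  refine ⟨?_, ?_, ?_, ?_⟩
  · rw [Finset.insert_sdiff_of_notMem _ haγ, Finset.insert_sdiff_of_notMem _ hbγ]
  · rw [Finset.insert_sdiff_of_notMem _ (by rw [Finset.mem_insert, not_or]; exact ⟨hab, haγ⟩), Finset.insert_sdiff_insert,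
      Finset.sdiff_insert_of_notMem hbM]
  · rw [Finset.insert_sdiff_insert, Finset.sdiff_insert_of_notMem (by rw [Finset.mem_insert, not_or]; exact ⟨hab, haM⟩),
      Finset.insert_sdiff_of_notMem _ hbγ]
  · rw [Finset.insert_sdiff_insert, Finset.sdiff_insert_of_notMem (by rw [Finset.mem_insert, not_or]; exact ⟨hab, haM⟩),
      Finset.insert_sdiff_insert, Finset.sdiff_insert_of_notMem hbM]

/-- **GADGET, CONTRACTED EDGE**: `q² · apPsiC q (M ∪ {um, mv}) (C ∪ {uv}) f g = (2 + 2q) · apPsiC q M (C ∪ {uv}) f g` for `m` isolated from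
`M ∪ C`, `m ≠ u, v`, `u ≠ v`, `f, g` not reading `um, mv`. [cite: Grimmett2006, §1.4 eq. (1.20) (p. 15)] -/
theorem gadget_contract_eq (huv : u ≠ v) (hum : u ≠ m) (hvm : v ≠ m)
    (hmM : ∀ e ∈ M, m ∉ e) (hmC : ∀ e ∈ C, m ∉ e)
    (hfa : ∀ A : Finset (Sym2 V), f (insert s(u, m) A) = f A) (hfb : ∀ A : Finset (Sym2 V), f (insert s(m, v) A) = f A)
    (hga : ∀ A : Finset (Sym2 V), g (insert s(u, m) A) = g A) (hgb : ∀ A : Finset (Sym2 V), g (insert s(m, v) A) = g A) :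
    q ^ 2 * apPsiC q (insert s(u, m) (insert s(m, v) M)) (insert s(u, v) C) f g =
      (2 + 2 * q) * apPsiC q M (insert s(u, v) C) f g := by
  set a := s(u, m) with ha
  set b := s(m, v) with hb
  set e := s(u, v) with he
  have hab : a ≠ b := by
    intro h; rw [ha, hb, Sym2.eq_iff] at h
    rcases h with ⟨h1, _⟩ | ⟨h1, _⟩
    · exact hum h1
    · exact huv h1
  have haM : a ∉ M := fun h => hmM a h (Sym2.mem_mk_right _ _)
  have hbM : b ∉ M := fun h => hmM b h (Sym2.mem_mk_left _ _)
  have hmC' : ∀ e' ∈ insert e C, m ∉ e' := by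
    intro e' he' hm
    rcases Finset.mem_insert.1 he' with rfl | he'
    · rcases Sym2.mem_iff.1 hm with h | h
      · exact hum h.symm
      · exact hvm h.symm
    · exact hmC e' he' hm
  -- isolation of m in the old replica configurations, which all contain e
  have iso : ∀ γ : Finset (Sym2 V), γ ⊆ M → ∀ e' ∈ γ ∪ insert e C, m ∉ e' := by
    intro γ hγ e' he'
    rcases Finset.mem_union.1 he' with h | h
    · exact hmM e' (hγ h)
    · exact hmC' e' h
  have reach : ∀ γ : Finset (Sym2 V), (openGraph (↑(γ ∪ insert e C) : BondConfig V)).Reachable u v := fun γ =>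
    reachable_of_mem_edge huv (Finset.mem_union_right _ (Finset.mem_insert_self _ _))
  unfold apPsiC
  rw [Finset.sum_powerset_insert (by rw [Finset.mem_insert, not_or]; exact ⟨hab, haM⟩ : a ∉ insert b M),
    Finset.sum_powerset_insert hbM, Finset.sum_powerset_insert hbM,
    ← Finset.sum_add_distrib, ← Finset.sum_add_distrib, ← Finset.sum_add_distrib, Finset.mul_sum, Finset.mul_sum]
  refine Finset.sum_congr rfl fun γ hγ => ?_
  rw [Finset.mem_powerset] at hγ
  obtain ⟨s1, s2, s3, s4⟩ := sdiff_gadget hab haM hbM hγ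
  have hγc : M \ γ ⊆ M := Finset.sdiff_subset
  -- exponents of the four states
  unfold apExpC
  rw [s1, s2, s3, s4]
  simp only [Finset.insert_union, hfa, hfb, hga, hgb]
  have k1a : clusterCount (↑(insert a (γ ∪ insert e C)) : BondConfig V) ∅ + 1 =
      clusterCount (↑(γ ∪ insert e C) : BondConfig V) ∅ := by
    rw [ha, Sym2.eq_swap]; exact clusterCount_insert_pendant (iso γ hγ) hum.symm
  have k1b : clusterCount (↑(insert b (γ ∪ insert e C)) : BondConfig V) ∅ + 1 =
      clusterCount (↑(γ ∪ insert e C) : BondConfig V) ∅ := clusterCount_insert_pendant (iso γ hγ) hvm.symm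
  have k1ab := clusterCount_insert_path2 (iso γ hγ) hum hvm (X := γ ∪ insert e C)
  rw [if_pos (reach γ), add_zero, ← ha, ← hb] at k1ab
  have k2a : clusterCount (↑(insert a ((M \ γ) ∪ insert e C)) : BondConfig V) ∅ + 1 =
      clusterCount (↑((M \ γ) ∪ insert e C) : BondConfig V) ∅ := by
    rw [ha, Sym2.eq_swap]; exact clusterCount_insert_pendant (iso (M \ γ) hγc) hum.symm
  have k2b : clusterCount (↑(insert b ((M \ γ) ∪ insert e C)) : BondConfig V) ∅ + 1 =
      clusterCount (↑((M \ γ) ∪ insert e C) : BondConfig V) ∅ := clusterCount_insert_pendant (iso (M \ γ) hγc) hvm.symm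
  have k2ab := clusterCount_insert_path2 (iso (M \ γ) hγc) hum hvm (X := (M \ γ) ∪ insert e C)
  rw [if_pos (reach (M \ γ)), add_zero, ← ha, ← hb] at k2ab
  -- abbreviate
  set R1 := clusterCount (↑(γ ∪ insert e C) : BondConfig V) ∅ with hR1
  set R2 := clusterCount (↑((M \ γ) ∪ insert e C) : BondConfig V) ∅ with hR2
  set F := (f (γ ∪ insert e C) - f ((M \ γ) ∪ insert e C)) * (g (γ ∪ insert e C) - g ((M \ γ) ∪ insert e C)) with hF
  have e00 : clusterCount (↑(γ ∪ insert e C) : BondConfig V) ∅ +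
      clusterCount (↑(insert a (insert b ((M \ γ) ∪ insert e C))) : BondConfig V) ∅ + 1 = R1 + R2 := by omega
  have e0b : clusterCount (↑(insert b (γ ∪ insert e C)) : BondConfig V) ∅ +
      clusterCount (↑(insert a ((M \ γ) ∪ insert e C)) : BondConfig V) ∅ + 2 = R1 + R2 := by omega
  have ea0 : clusterCount (↑(insert a (γ ∪ insert e C)) : BondConfig V) ∅ +
      clusterCount (↑(insert b ((M \ γ) ∪ insert e C)) : BondConfig V) ∅ + 2 = R1 + R2 := by omega
  have eab : clusterCount (↑(insert a (insert b (γ ∪ insert e C))) : BondConfig V) ∅ +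
      clusterCount (↑((M \ γ) ∪ insert e C) : BondConfig V) ∅ + 1 = R1 + R2 := by omega
  have p00 : q ^ 2 * q ^ (clusterCount (↑(γ ∪ insert e C) : BondConfig V) ∅ +
      clusterCount (↑(insert a (insert b ((M \ γ) ∪ insert e C))) : BondConfig V) ∅) = q * q ^ (R1 + R2) := by
    rw [← e00]; ring
  have p0b : q ^ 2 * q ^ (clusterCount (↑(insert b (γ ∪ insert e C)) : BondConfig V) ∅ +
      clusterCount (↑(insert a ((M \ γ) ∪ insert e C)) : BondConfig V) ∅) = q ^ (R1 + R2) := by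
    rw [← e0b]; ring
  have pa0 : q ^ 2 * q ^ (clusterCount (↑(insert a (γ ∪ insert e C)) : BondConfig V) ∅ +
      clusterCount (↑(insert b ((M \ γ) ∪ insert e C)) : BondConfig V) ∅) = q ^ (R1 + R2) := by
    rw [← ea0]; ring
  have pab : q ^ 2 * q ^ (clusterCount (↑(insert a (insert b (γ ∪ insert e C))) : BondConfig V) ∅ +
      clusterCount (↑((M \ γ) ∪ insert e C) : BondConfig V) ∅) = q * q ^ (R1 + R2) := by
    rw [← eab]; ring
  calc q ^ 2 * (q ^ (clusterCount (↑(γ ∪ insert e C) : BondConfig V) ∅ +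
            clusterCount (↑(insert a (insert b ((M \ γ) ∪ insert e C))) : BondConfig V) ∅) * F +
          q ^ (clusterCount (↑(insert b (γ ∪ insert e C)) : BondConfig V) ∅ +
            clusterCount (↑(insert a ((M \ γ) ∪ insert e C)) : BondConfig V) ∅) * F +
        (q ^ (clusterCount (↑(insert a (γ ∪ insert e C)) : BondConfig V) ∅ +
            clusterCount (↑(insert b ((M \ γ) ∪ insert e C)) : BondConfig V) ∅) * F +
          q ^ (clusterCount (↑(insert a (insert b (γ ∪ insert e C))) : BondConfig V) ∅ +
            clusterCount (↑((M \ γ) ∪ insert e C) : BondConfig V) ∅) * F))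
      = (q ^ 2 * q ^ (clusterCount (↑(γ ∪ insert e C) : BondConfig V) ∅ +
            clusterCount (↑(insert a (insert b ((M \ γ) ∪ insert e C))) : BondConfig V) ∅)) * F +
          (q ^ 2 * q ^ (clusterCount (↑(insert b (γ ∪ insert e C)) : BondConfig V) ∅ +
            clusterCount (↑(insert a ((M \ γ) ∪ insert e C)) : BondConfig V) ∅)) * F +
        ((q ^ 2 * q ^ (clusterCount (↑(insert a (γ ∪ insert e C)) : BondConfig V) ∅ +
            clusterCount (↑(insert b ((M \ γ) ∪ insert e C)) : BondConfig V) ∅)) * F +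
          (q ^ 2 * q ^ (clusterCount (↑(insert a (insert b (γ ∪ insert e C))) : BondConfig V) ∅ +
            clusterCount (↑((M \ γ) ∪ insert e C) : BondConfig V) ∅)) * F) := by ring
    _ = (2 + 2 * q) * (q ^ (R1 + R2) * F) := by rw [p00, p0b, pa0, pab]; ring

/-- **GADGET, DELETED EDGE**: `q² · apPsiC q (M ∪ {um, mv}) C f g = 2 · apPsiC q M C f g + q · apPsiC q (M ∪ {uv}) C f g` for `m` isolated from
`M ∪ C`, `m ≠ u, v`, `u ≠ v`, `uv ∉ M ∪ C`, `f, g` not reading `uv, um, mv`. [cite: Grimmett2006, §1.4 eq. (1.20) (p. 15)] -/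
theorem gadget_delete_eq (huv : u ≠ v) (hum : u ≠ m) (hvm : v ≠ m)
    (hmM : ∀ e ∈ M, m ∉ e) (hmC : ∀ e ∈ C, m ∉ e) (heM : s(u, v) ∉ M)
    (hfe : ∀ A : Finset (Sym2 V), f (insert s(u, v) A) = f A)
    (hfa : ∀ A : Finset (Sym2 V), f (insert s(u, m) A) = f A) (hfb : ∀ A : Finset (Sym2 V), f (insert s(m, v) A) = f A)
    (hge : ∀ A : Finset (Sym2 V), g (insert s(u, v) A) = g A)
    (hga : ∀ A : Finset (Sym2 V), g (insert s(u, m) A) = g A) (hgb : ∀ A : Finset (Sym2 V), g (insert s(m, v) A) = g A) :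
    q ^ 2 * apPsiC q (insert s(u, m) (insert s(m, v) M)) C f g =
      2 * apPsiC q M C f g + q * apPsiC q (insert s(u, v) M) C f g := by
  set a := s(u, m) with ha
  set b := s(m, v) with hb
  set e := s(u, v) with he
  have hab : a ≠ b := by
    intro h; rw [ha, hb, Sym2.eq_iff] at h
    rcases h with ⟨h1, _⟩ | ⟨h1, _⟩
    · exact hum h1
    · exact huv h1
  have haM : a ∉ M := fun h => hmM a h (Sym2.mem_mk_right _ _)
  have hbM : b ∉ M := fun h => hmM b h (Sym2.mem_mk_left _ _)
  have iso : ∀ γ : Finset (Sym2 V), γ ⊆ M → ∀ e' ∈ γ ∪ C, m ∉ e' := by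
    intro γ hγ e' he'
    rcases Finset.mem_union.1 he' with h | h
    · exact hmM e' (hγ h)
    · exact hmC e' h
  unfold apPsiC
  rw [Finset.sum_powerset_insert (by rw [Finset.mem_insert, not_or]; exact ⟨hab, haM⟩ : a ∉ insert b M),
    Finset.sum_powerset_insert hbM, Finset.sum_powerset_insert hbM, Finset.sum_powerset_insert heM,
    ← Finset.sum_add_distrib, ← Finset.sum_add_distrib, ← Finset.sum_add_distrib, ← Finset.sum_add_distrib,
    Finset.mul_sum, Finset.mul_sum, Finset.mul_sum, ← Finset.sum_add_distrib]
  refine Finset.sum_congr rfl fun γ hγ => ?_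
  rw [Finset.mem_powerset] at hγ
  obtain ⟨s1, s2, s3, s4⟩ := sdiff_gadget hab haM hbM hγ
  have hγc : M \ γ ⊆ M := Finset.sdiff_subset
  have heγ : e ∉ γ := fun h => heM (hγ h)
  have t1 : insert e M \ γ = insert e (M \ γ) := Finset.insert_sdiff_of_notMem _ heγ
  have t2 : insert e M \ insert e γ = M \ γ := by rw [Finset.insert_sdiff_insert, Finset.sdiff_insert_of_notMem heM]
  unfold apExpC
  rw [s1, s2, s3, s4, t1, t2]
  simp only [Finset.insert_union, hfa, hfb, hga, hgb, hfe, hge]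
  -- cluster counts
  set R1 := clusterCount (↑(γ ∪ C) : BondConfig V) ∅ with hR1
  set R2 := clusterCount (↑((M \ γ) ∪ C) : BondConfig V) ∅ with hR2
  set F := (f (γ ∪ C) - f ((M \ γ) ∪ C)) * (g (γ ∪ C) - g ((M \ γ) ∪ C)) with hF
  have k1a : clusterCount (↑(insert a (γ ∪ C)) : BondConfig V) ∅ + 1 = R1 := by
    rw [ha, Sym2.eq_swap]; exact clusterCount_insert_pendant (iso γ hγ) hum.symm
  have k1b : clusterCount (↑(insert b (γ ∪ C)) : BondConfig V) ∅ + 1 = R1 := clusterCount_insert_pendant (iso γ hγ) hvm.symm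
  have k1ab := clusterCount_insert_path2 (iso γ hγ) hum hvm (X := γ ∪ C)
  rw [← ha, ← hb] at k1ab
  have k1e := clusterCount_insert_add_ite (γ ∪ C) u v
  rw [← he] at k1e
  have k2a : clusterCount (↑(insert a ((M \ γ) ∪ C)) : BondConfig V) ∅ + 1 = R2 := by
    rw [ha, Sym2.eq_swap]; exact clusterCount_insert_pendant (iso (M \ γ) hγc) hum.symm
  have k2b : clusterCount (↑(insert b ((M \ γ) ∪ C)) : BondConfig V) ∅ + 1 = R2 :=
    clusterCount_insert_pendant (iso (M \ γ) hγc) hvm.symm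
  have k2ab := clusterCount_insert_path2 (iso (M \ γ) hγc) hum hvm (X := (M \ γ) ∪ C)
  rw [← ha, ← hb] at k2ab
  have k2e := clusterCount_insert_add_ite ((M \ γ) ∪ C) u v
  rw [← he] at k2e
  -- power identities for the four states and the two e-terms
  have p00 := pow_gadget1 (q := q) (E := R1 + R2)
    (n := clusterCount (↑(γ ∪ C) : BondConfig V) ∅ + clusterCount (↑(insert a (insert b ((M \ γ) ∪ C))) : BondConfig V) ∅)
    (P := (openGraph (↑((M \ γ) ∪ C) : BondConfig V)).Reachable u v) (by split_ifs at k2ab ⊢ <;> omega)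
  have p0b := pow_gadget2 (q := q) (E := R1 + R2)
    (n := clusterCount (↑(insert b (γ ∪ C)) : BondConfig V) ∅ + clusterCount (↑(insert a ((M \ γ) ∪ C)) : BondConfig V) ∅) (by omega)
  have pa0 := pow_gadget2 (q := q) (E := R1 + R2)
    (n := clusterCount (↑(insert a (γ ∪ C)) : BondConfig V) ∅ + clusterCount (↑(insert b ((M \ γ) ∪ C)) : BondConfig V) ∅) (by omega)
  have pab := pow_gadget1 (q := q) (E := R1 + R2)
    (n := clusterCount (↑(insert a (insert b (γ ∪ C))) : BondConfig V) ∅ + clusterCount (↑((M \ γ) ∪ C) : BondConfig V) ∅)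
    (P := (openGraph (↑(γ ∪ C) : BondConfig V)).Reachable u v) (by split_ifs at k1ab ⊢ <;> omega)
  have pe1 := pow_gadgetT (q := q) (E := R1 + R2)
    (n := clusterCount (↑(γ ∪ C) : BondConfig V) ∅ + clusterCount (↑(insert e ((M \ γ) ∪ C)) : BondConfig V) ∅)
    (P := (openGraph (↑((M \ γ) ∪ C) : BondConfig V)).Reachable u v) (by split_ifs at k2e ⊢ <;> omega)
  have pe2 := pow_gadgetT (q := q) (E := R1 + R2)
    (n := clusterCount (↑(insert e (γ ∪ C)) : BondConfig V) ∅ + clusterCount (↑((M \ γ) ∪ C) : BondConfig V) ∅)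
    (P := (openGraph (↑(γ ∪ C) : BondConfig V)).Reachable u v) (by split_ifs at k1e ⊢ <;> omega)
  -- assemble
  set ι2 : ℝ := if (openGraph (↑((M \ γ) ∪ C) : BondConfig V)).Reachable u v then q else 1 with hι2
  set ι1 : ℝ := if (openGraph (↑(γ ∪ C) : BondConfig V)).Reachable u v then q else 1 with hι1
  calc q ^ 2 * (q ^ (clusterCount (↑(γ ∪ C) : BondConfig V) ∅ +
            clusterCount (↑(insert a (insert b ((M \ γ) ∪ C))) : BondConfig V) ∅) * F +
          q ^ (clusterCount (↑(insert b (γ ∪ C)) : BondConfig V) ∅ + clusterCount (↑(insert a ((M \ γ) ∪ C)) : BondConfig V) ∅) * F +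
        (q ^ (clusterCount (↑(insert a (γ ∪ C)) : BondConfig V) ∅ + clusterCount (↑(insert b ((M \ γ) ∪ C)) : BondConfig V) ∅) * F +
          q ^ (clusterCount (↑(insert a (insert b (γ ∪ C))) : BondConfig V) ∅ + clusterCount (↑((M \ γ) ∪ C) : BondConfig V) ∅) * F))
      = (q ^ 2 * q ^ (clusterCount (↑(γ ∪ C) : BondConfig V) ∅ +
            clusterCount (↑(insert a (insert b ((M \ γ) ∪ C))) : BondConfig V) ∅)) * F +
          (q ^ 2 * q ^ (clusterCount (↑(insert b (γ ∪ C)) : BondConfig V) ∅ +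
            clusterCount (↑(insert a ((M \ γ) ∪ C)) : BondConfig V) ∅)) * F +
        ((q ^ 2 * q ^ (clusterCount (↑(insert a (γ ∪ C)) : BondConfig V) ∅ +
            clusterCount (↑(insert b ((M \ γ) ∪ C)) : BondConfig V) ∅)) * F +
          (q ^ 2 * q ^ (clusterCount (↑(insert a (insert b (γ ∪ C))) : BondConfig V) ∅ +
            clusterCount (↑((M \ γ) ∪ C) : BondConfig V) ∅)) * F) := by ring
    _ = ι2 * q ^ (R1 + R2) * F + q ^ (R1 + R2) * F + (q ^ (R1 + R2) * F + ι1 * q ^ (R1 + R2) * F) := by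
      rw [p00, p0b, pa0, pab]
    _ = 2 * (q ^ (R1 + R2) * F) +
        ((q * q ^ (clusterCount (↑(γ ∪ C) : BondConfig V) ∅ + clusterCount (↑(insert e ((M \ γ) ∪ C)) : BondConfig V) ∅)) * F +
          (q * q ^ (clusterCount (↑(insert e (γ ∪ C)) : BondConfig V) ∅ + clusterCount (↑((M \ γ) ∪ C) : BondConfig V) ∅)) * F) := by
      rw [pe1, pe2]; ring
    _ = _ := by ring


end Gadget

end FK

end Summit.CriticalPhenomena.PercolationContinuityZ3.Theorems

end
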